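import Literature.Algebra.Homology.EulerPoincareRank
import Mathlib.Algebra.Homology.HomologySequence
import HarnessLib

/-!
# Additivity of the Euler characteristics along a short exact sequence of complexes, for RANKS over a ring with rank–nullity

Layer `Literature/Algebra/Homology` (pure algebra over Mathlib; proved theorems only, 0 definitions, 0 named facts, no instances, no notation).
Rows `EulerCharacteristicShortExact` ∕ `HomologyEulerCharacteristicShortExact` prove `χ(X₂) = χ(X₁) + χ(X₃)`, `χ_H(X₂) = χ_H(X₁) + χ_H(X₃)` for complexes
of VECTOR SPACES (`[DivisionRing K]`); they are neither imported nor restated. Here both additivities over any ring `R` with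
`[HasRankNullity R] [StrongRankCondition R]` (every division ring, every commutative domain; for `R = ℤ`: RANKS of finitely generated abelian groups,
torsion allowed — Hatcher's `χ(X) = χ(A) + χ(X, A)`, Spanier 4.3.14), the generalisation step row `EulerPoincareRank` made for `EulerPoincareFormula`:
modules — `rank_range_add_of_exact` ∕ `rank_X₂_eq_add_of_shortExact` in `Cardinal` with NO finiteness, `finrank_range_add_finrank_ker`,
`finrank_range_add_of_exact`, `finrank_eq_add_of_exact`, `finrank_X₂_eq_add_of_shortExact`; complexes of ANY shape along `S.ShortExact`,
`S : ShortComplex (HomologicalComplex (ModuleCat R) c)` — **`eulerChar_X₂_eq_add : χ(X₂) = χ(X₁) + χ(X₃)`** and **`homologyEulerChar_X₂_eq_add :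
χ_H(X₂) = χ_H(X₁) + χ_H(X₃)`** (homology of `X₁`, `X₃` finitely generated, of non-zero rank in finitely many degrees; the long exact homology sequence,
Mathlib `ShortExact.homology_exact₁∕₂∕₃` + `mono∕epi_homologyMap_of_…_of_not_rel`, the ranks telescoped by row `EulerPoincarePrinciple`'s
`HopfTrace.finsum_χ_smul_eq_of_degreewise`). DEDUP: `AlgebraicTopology/SingularHomology/EulerCharacteristicTriple` has rank additivity for its own
`ℕ`-graded `GradedLES` of singular homology (not a `ShortComplex.ShortExact` of `HomologicalComplex`es; not imported — layer hygiene). Library only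
(cell `pub-hodge-ring2`, count-neutral); proves nothing about any crux, route or conjecture.

## References

* A. Hatcher, *Algebraic Topology* (2002), §2.2, Thm. 2.44 and the rank bookkeeping for pairs. [HatcherAT2002]
* E. H. Spanier, *Algebraic Topology* (1981), Ch. 4 §3, Thm. 14 (`χ(X, B) = χ(A, B) + χ(X, A)`). [Spanier1981]
* U. Görtz, T. Wedhorn, *Algebraic Geometry II* (2023), Remark 23.62 (2). [GortzWedhorn2023]
-/

open CategoryTheory CategoryTheory.Limits Cardinal

universe v u w

namespace Literature.Algebra.Homology.EulerCharShortExactRank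

variable {R : Type u} [Ring R]

/-- Rank–nullity along an exact `X₁ → X₂ → X₃`, NO finiteness: `rank (range g) + rank (range f) = rank X₂` in `Cardinal`. [cite: HatcherAT2002, §2.2] -/
theorem rank_range_add_of_exact [HasRankNullity.{v} R] {T : ShortComplex (ModuleCat.{v} R)} (hT : T.Exact) :
    Module.rank R (LinearMap.range T.g.hom) + Module.rank R (LinearMap.range T.f.hom) = Module.rank R T.X₂ := by
  rw [hT.moduleCat_range_eq_ker, ← LinearEquiv.rank_eq T.g.hom.quotKerEquivRange]
  exact Submodule.rank_quotient_add_rank _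

/-- **`rank X₂ = rank X₁ + rank X₃`** in a short exact sequence, in `Cardinal`, NO finiteness ("rank B = rank A + rank C"). [cite: HatcherAT2002, Thm. 2.44] -/
theorem rank_X₂_eq_add_of_shortExact [HasRankNullity.{v} R] {T : ShortComplex (ModuleCat.{v} R)} (hT : T.ShortExact) :
    Module.rank R T.X₂ = Module.rank R T.X₁ + Module.rank R T.X₃ := by
  rw [← rank_range_add_of_exact hT.exact, LinearMap.range_eq_top.2 ((ModuleCat.epi_iff_surjective _).1 hT.epi_g), rank_top,
    ← LinearEquiv.rank_eq (LinearEquiv.ofInjective T.f.hom ((ModuleCat.mono_iff_injective _).1 hT.mono_f)), add_comm]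

/-- Rank–nullity with `Module.finrank` for a map out of a finitely generated module. [cite: HatcherAT2002, §2.2] -/
theorem finrank_range_add_finrank_ker [HasRankNullity.{v} R] [StrongRankCondition R] {M N : ModuleCat.{v} R} [Module.Finite R M]
    (f : M →ₗ[R] N) : Module.finrank R (LinearMap.range f) + Module.finrank R (LinearMap.ker f) = Module.finrank R M := by
  rw [← f.quotKerEquivRange.finrank_eq]
  exact Submodule.finrank_quotient_add_finrank _

/-- `rk g + rk f = rank X₂` along an exact `X₁ → X₂ → X₃` with `X₂` finitely generated. [cite: HatcherAT2002, §2.2] -/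
theorem finrank_range_add_of_exact [HasRankNullity.{v} R] [StrongRankCondition R] {T : ShortComplex (ModuleCat.{v} R)} (hT : T.Exact)
    [Module.Finite R T.X₂] : Module.finrank R (LinearMap.range T.g.hom) + Module.finrank R (LinearMap.range T.f.hom) = Module.finrank R T.X₂ := by
  rw [hT.moduleCat_range_eq_ker]
  exact finrank_range_add_finrank_ker T.g.hom

/-- `rank X₂ = rk g + rk f` along an exact `X₁ → X₂ → X₃` with `X₁`, `X₃` finitely generated (`X₂` need not be). [cite: HatcherAT2002, §2.2] -/
theorem finrank_eq_add_of_exact [HasRankNullity.{v} R] [StrongRankCondition R] {T : ShortComplex (ModuleCat.{v} R)} (hT : T.Exact)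
    [Module.Finite R T.X₁] [Module.Finite R T.X₃] :
    Module.finrank R T.X₂ = Module.finrank R (LinearMap.range T.g.hom) + Module.finrank R (LinearMap.range T.f.hom) := by
  have hg : Module.rank R (LinearMap.range T.g.hom) < ℵ₀ := (Submodule.rank_le _).trans_lt (Module.rank_lt_aleph0 R T.X₃)
  have hf : Module.rank R (LinearMap.range T.f.hom) < ℵ₀ := (rank_range_le T.f.hom).trans_lt (Module.rank_lt_aleph0 R T.X₁)
  have e := congrArg Cardinal.toNat (rank_range_add_of_exact hT).symm
  rw [Cardinal.toNat_add hg hf] at e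
  exact e

/-- `rank X₂ = rank X₁ + rank X₃` with `Module.finrank`, `X₁`, `X₃` finitely generated. [cite: HatcherAT2002, Thm. 2.44] -/
theorem finrank_X₂_eq_add_of_shortExact [HasRankNullity.{v} R] [StrongRankCondition R] {T : ShortComplex (ModuleCat.{v} R)} (hT : T.ShortExact)
    [Module.Finite R T.X₁] [Module.Finite R T.X₃] : Module.finrank R T.X₂ = Module.finrank R T.X₁ + Module.finrank R T.X₃ := by
  have e := congrArg Cardinal.toNat (rank_X₂_eq_add_of_shortExact hT)
  rw [Cardinal.toNat_add (Module.rank_lt_aleph0 R T.X₁) (Module.rank_lt_aleph0 R T.X₃)] at e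
  exact e

variable {ι : Type w} {c : ComplexShape ι} {S : ShortComplex (HomologicalComplex (ModuleCat.{v} R) c)}

/-- A signed function dominated by the ranks of a finitely supported graded object has finite support. [cite: HatcherAT2002, §2.2] -/
theorem hasFiniteSupport_χ_mul_of_le [c.EulerCharSigns] {X : GradedObject ι (ModuleCat.{v} R)}
    (hX : (GradedObject.finrankSupport X).Finite) {g : ι → ℕ} (hg : ∀ i, g i ≤ Module.finrank R (X i)) :
    (fun i => (c.χ i : ℤ) * (g i : ℤ)).HasFiniteSupport := by
  refine hX.subset fun i hi => ?_
  have h := hg i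
  simp only [GradedObject.finrankSupport, Function.mem_support, ne_eq, mul_eq_zero, Units.ne_zero, Int.natCast_eq_zero, false_or] at hi ⊢
  omega

/-- Degreewise `rank X₂ⁱ = rank X₁ⁱ + rank X₃ⁱ` in a short exact sequence of complexes. [cite: HatcherAT2002, Thm. 2.44] -/
theorem finrank_X_X₂_eq_add [HasRankNullity.{v} R] [StrongRankCondition R] (hS : S.ShortExact) (i : ι) [Module.Finite R (S.X₁.X i)]
    [Module.Finite R (S.X₃.X i)] : Module.finrank R (S.X₂.X i) = Module.finrank R (S.X₁.X i) + Module.finrank R (S.X₃.X i) :=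
  haveI : Module.Finite R (S.map (HomologicalComplex.eval _ _ i)).X₁ := inferInstanceAs (Module.Finite R (S.X₁.X i))
  haveI : Module.Finite R (S.map (HomologicalComplex.eval _ _ i)).X₃ := inferInstanceAs (Module.Finite R (S.X₃.X i))
  finrank_X₂_eq_add_of_shortExact (T := S.map (HomologicalComplex.eval _ _ i)) (hS.map_of_exact (HomologicalComplex.eval _ _ i))

/-- **`χ(X₂) = χ(X₁) + χ(X₃)`** for Mathlib's `HomologicalComplex.eulerChar` along a short exact sequence of complexes of finitely generated modules
over a ring with rank–nullity, any shape, `X₁`, `X₃` with finitely many terms of non-zero rank. [cite: HatcherAT2002, Thm. 2.44]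
[cite: GortzWedhorn2023, Remark 23.62 (2)] -/
theorem eulerChar_X₂_eq_add [c.EulerCharSigns] [HasRankNullity.{v} R] [StrongRankCondition R] (hS : S.ShortExact)
    [∀ i, Module.Finite R (S.X₁.X i)] [∀ i, Module.Finite R (S.X₃.X i)] (h₁ : (GradedObject.finrankSupport S.X₁.X).Finite)
    (h₃ : (GradedObject.finrankSupport S.X₃.X).Finite) : S.X₂.eulerChar = S.X₁.eulerChar + S.X₃.eulerChar := by
  simp only [HomologicalComplex.eulerChar, GradedObject.eulerChar]
  rw [← finsum_add_distrib (hasFiniteSupport_χ_mul_of_le h₁ fun i => le_rfl) (hasFiniteSupport_χ_mul_of_le h₃ fun i => le_rfl)]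
  exact finsum_congr fun i => by rw [finrank_X_X₂_eq_add hS i]; push_cast; ring

/-- Across a step `c.Rel i j`, `rank ker Hʲ(f) = rank Hⁱ(X₃) − rk Hⁱ(g)` (both = the rank of the connecting map). [cite: HatcherAT2002, §2.2] -/
theorem finrank_ker_homologyMap_f_eq_of_rel [HasRankNullity.{v} R] [StrongRankCondition R] (hS : S.ShortExact) (i j : ι) (hij : c.Rel i j)
    [Module.Finite R (S.X₁.homology j)] [Module.Finite R (S.X₃.homology i)] :
    Module.finrank R (LinearMap.ker (HomologicalComplex.homologyMap S.f j).hom) =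
      Module.finrank R (S.X₃.homology i) - Module.finrank R (LinearMap.range (HomologicalComplex.homologyMap S.g i).hom) := by
  have h3 := finrank_range_add_of_exact (hS.homology_exact₃ i j hij)
  have h1 := finrank_range_add_of_exact (hS.homology_exact₁ i j hij)
  have hrn := finrank_range_add_finrank_ker (HomologicalComplex.homologyMap S.f j).hom
  simp only at h3 h1
  omega

/-- **`χ_H(X₂) = χ_H(X₁) + χ_H(X₃)`** along a short exact sequence of complexes of ANY shape over a ring with rank–nullity (`ℤ`: ranks of finitely
generated abelian groups): homology of `X₁`, `X₃` finitely generated in every degree, of non-zero rank in finitely many.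
[cite: HatcherAT2002, §2.2] [cite: Spanier1981, Ch. 4 §3 Thm. 14] [cite: GortzWedhorn2023, Remark 23.62 (2)] -/
theorem homologyEulerChar_X₂_eq_add [c.EulerCharSigns] [HasRankNullity.{v} R] [StrongRankCondition R] (hS : S.ShortExact)
    [∀ i, Module.Finite R (S.X₁.homology i)] [∀ i, Module.Finite R (S.X₃.homology i)]
    (h₁ : (GradedObject.finrankSupport fun i => S.X₁.homology i).Finite) (h₃ : (GradedObject.finrankSupport fun i => S.X₃.homology i).Finite) :
    S.X₂.homologyEulerChar = S.X₁.homologyEulerChar + S.X₃.homologyEulerChar := by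
  haveI : Nontrivial R := nontrivial_of_hasRankNullity R
  simp only [HomologicalComplex.homologyEulerChar, GradedObject.eulerChar]
  have e₂ : ∀ i, (Module.finrank R (S.X₂.homology i) : ℤ) = Module.finrank R (LinearMap.range (HomologicalComplex.homologyMap S.g i).hom) +
      Module.finrank R (LinearMap.range (HomologicalComplex.homologyMap S.f i).hom) := fun i => by
    rw [finrank_eq_add_of_exact (hS.homology_exact₂ i)]; push_cast; rfl
  have e₁ : ∀ i, (Module.finrank R (S.X₁.homology i) : ℤ) = Module.finrank R (LinearMap.range (HomologicalComplex.homologyMap S.f i).hom) +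
      Module.finrank R (LinearMap.ker (HomologicalComplex.homologyMap S.f i).hom) := fun i => by
    rw [← finrank_range_add_finrank_ker (HomologicalComplex.homologyMap S.f i).hom]; push_cast; rfl
  have hle : ∀ i, Module.finrank R (LinearMap.range (HomologicalComplex.homologyMap S.g i).hom) ≤ Module.finrank R (S.X₃.homology i) :=
    fun i => Submodule.finrank_le _
  have key := HopfTrace.finsum_χ_smul_eq_of_degreewise (c := c) (M := ℤ)
    (fun i => (Module.finrank R (S.X₁.homology i) : ℤ) + Module.finrank R (S.X₃.homology i))
    (fun i => (Module.finrank R (S.X₂.homology i) : ℤ))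
    (fun i => (Module.finrank R (S.X₃.homology i) : ℤ) - Module.finrank R (LinearMap.range (HomologicalComplex.homologyMap S.g i).hom))
    (fun j => (Module.finrank R (LinearMap.ker (HomologicalComplex.homologyMap S.f j).hom) : ℤ))
    (fun i => by rw [e₁ i, e₂ i]; ring)
    (fun j hj => by
      haveI := hS.mono_f
      haveI : Mono (HomologicalComplex.homologyMap S.f j) :=
        HomologicalComplex.mono_homologyMap_of_mono_of_not_rel S.f j fun i hi => hj (by rwa [c.prev_eq' hi])
      rw [LinearMap.ker_eq_bot.2 ((ModuleCat.mono_iff_injective _).1 inferInstance), finrank_bot, Nat.cast_zero])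
    (fun i hi => by
      haveI := hS.epi_g
      haveI : Epi (HomologicalComplex.homologyMap S.g i) :=
        HomologicalComplex.epi_homologyMap_of_epi_of_not_rel S.g i fun j hj => hi (by rwa [c.next_eq' hj])
      rw [LinearMap.range_eq_top.2 ((ModuleCat.epi_iff_surjective _).1 inferInstance), finrank_top, sub_self])
    (fun i j hij => by rw [finrank_ker_homologyMap_f_eq_of_rel hS i j hij, Nat.cast_sub (hle i)])
    ((h₁.union h₃).subset fun i hi => by
      simp only [GradedObject.finrankSupport, Function.mem_support, ne_eq, Set.mem_union] at hi ⊢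
      have h2 := finrank_eq_add_of_exact (hS.homology_exact₂ i)
      simp only at h2
      have := Submodule.finrank_le (LinearMap.range (HomologicalComplex.homologyMap S.g i).hom)
      have := LinearMap.finrank_range_le (M := S.X₁.homology i) (HomologicalComplex.homologyMap S.f i).hom
      omega)
    (h₃.subset fun i hi => by
      simp only [GradedObject.finrankSupport, Function.mem_support, ne_eq] at hi ⊢
      have := hle i; omega)
    (h₁.subset fun i hi => by
      simp only [GradedObject.finrankSupport, Function.mem_support, ne_eq, Int.natCast_eq_zero] at hi ⊢
      have := Submodule.finrank_le (LinearMap.ker (HomologicalComplex.homologyMap S.f i).hom); omega)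
  simp only [smul_eq_mul] at key
  rw [← finsum_add_distrib (hasFiniteSupport_χ_mul_of_le h₁ fun i => le_rfl) (hasFiniteSupport_χ_mul_of_le h₃ fun i => le_rfl), ← key]
  exact finsum_congr fun i => by ring

end Literature.Algebra.Homology.EulerCharShortExactRank
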